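import Mathlib
import Summits.HodgeConjecture.FermatCycles.HodgeFermatDecodingB

/-!
# THEOREM F* at the prime levels by point evaluation — part 3: the pattern cases and the assembly `thmFstar` (from `H0`) (`HodgeFermat/Decoding.lean`)

Tree copy (part 3 of 3) of the module `HodgeFermat/Decoding.lean` of the sibling cell's standalone package
`run/shared/lean/pub/pub-hodgefermat/lean/HodgeFermat/` (688 lines, sha256 `9f6bff044f160188…`), source lines 445–688 (§8 the four pattern cases `caseZ3Z3`, `caseZ3Z1`, `caseZ1Z1`, `caseUU`, the type-preserving permutations, the assembly `thmFstar_nf`, `thmFstar_nf1`, `thmFstar` from `H0`).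
Filed by cell `pub-hfermat`, seat prover-1 gen-0, on the COORDINATOR KEEPER RULING of 2026-08-25 (gem sweep H1: take the
off-gate kernel theorem `thmFstar` — `HodgeFermat/DecodingFinal.lean:29` — through the gate); this file is one link of the
minimal import closure of `thmFstar`.  The source module's declarations are VERBATIM those of the cell record
`check/DecodingFinal_standalone.lean` (27 bodies, 454 223 B, sha256 dca6f17de93119a6…, hub `lean check` rc 0, 130.1 s; pub-hodgefermat `CERT.md` l.978, GATE HF-G32).
Deviations from the source module, exhaustively: the `import` lines (tree modules `Summits.HodgeConjecture.FermatCycles.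
HodgeFermat*` instead of `HodgeFermat.*`); this module docstring; the namespace/`open` preamble (source l.26–34) is repeated at the top because the module is split; `section Level` with `variable {p : ℕ}` (source l.315–317) is re-opened before source l.445; one-line docstrings added (gate lint) to `st_symm`, `st_trans`, `unit_mul_not_dvd`, `rsum_swap`, `rsum_rot`, `st_swap`, `st_rot`. The module docstring is quoted in full in part 1.
Every other line — in particular every declaration's statement and proof — is byte-identical to the source.
HONEST FRAMING: explicit algebraic cycles for specific Hodge classes on Fermat/Delsarte varieties; residual open instances
listed; no claim on general Hodge.  (This file is arithmetic of CM types; it claims nothing about cycles.)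
-/

set_option autoImplicit false

namespace HodgeFermat.KRFree.Decoding

open HodgeFermat.KRFree.LemmaN HodgeFermat.KRFree.LemmaEMu
open HodgeFermat.KRFree.MuEven (muEntry muFun mu_even)
open HodgeFermat.KRFree.NuOdd (nuEntry nuFun)
open HodgeFermat.KRFree.NuOddSharp (nu_odd' nu_sum_eq')
open HodgeFermat.KRFree.ChiThree (chi3 chi3_ne_zero)

section Level

variable {p : ℕ}

/-! ## 8. THEOREM F* at level `3p`: the four pattern cases and the assembly -/

/-- (Z3, Z3) -/
theorem caseZ3Z3 (hp : p.Prime) (hp11 : 11 ≤ p) (hp13 : p ≠ 13) {a b c a' b' c' : ℕ}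
    (h3a : 3 ∣ a) (h3b : 3 ∣ b) (h3c : 3 ∣ c) (h3a' : 3 ∣ a') (h3b' : 3 ∣ b') (h3c' : 3 ∣ c')
    (hs : 3 * p ∣ a + b + c) (ha : Nat.Coprime a p) (hb : Nat.Coprime b p) (hc : Nat.Coprime c p)
    (hda : ¬ a ≡ a' [MOD 3 * p]) (hdb : ¬ a ≡ b' [MOD 3 * p]) (hdc : ¬ a ≡ c' [MOD 3 * p])
    (hE : ∀ x : ZMod p, muFun (a, b, c) (-x) - muFun (a', b', c') (-x) = muFun (a, b, c) x - muFun (a', b', c') x) :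
    False := by
  haveI : Fact p.Prime := ⟨hp⟩
  obtain ⟨n2, n3, n4, n5, n7, n8, n9, n13, n15⟩ := numerals (p := p) hp hp11 hp13
  exact core33 n2 (zsum_Z3 h3a h3b h3c hs) (third_ne_zero hp ha h3a) (third_ne_zero hp hb h3b)
    (third_ne_zero hp hc h3c) (third_ne_of_nmod h3a h3a' hda) (third_ne_of_nmod h3a h3b' hdb)
    (third_ne_of_nmod h3a h3c' hdc)
    (fun x => by simpa only [muFun_Z3 h3a h3b h3c, muFun_Z3 h3a' h3b' h3c'] using hE x)

/-- (Z3, Z1), the Z1 triple normalised as `(3y′, u′, v′)` -/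
theorem caseZ3Z1 (hp : p.Prime) (hp11 : 11 ≤ p) (hp13 : p ≠ 13) {a b c a' b' c' : ℕ}
    (h3a : 3 ∣ a) (h3b : 3 ∣ b) (h3c : 3 ∣ c) (h3a' : 3 ∣ a') (h3b' : ¬ 3 ∣ b') (h3c' : ¬ 3 ∣ c')
    (hs' : 3 * p ∣ a' + b' + c') (ha' : Nat.Coprime a' p) (hb' : Nat.Coprime b' p)
    (hda : ¬ a ≡ a' [MOD 3 * p]) (hdb : ¬ b ≡ a' [MOD 3 * p]) (hdc : ¬ c ≡ a' [MOD 3 * p])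
    (hE : ∀ x : ZMod p, muFun (a, b, c) (-x) - muFun (a', b', c') (-x) = muFun (a, b, c) x - muFun (a', b', c') x)
    (hD : ∀ x : ZMod p, nuFun (a, b, c) (-x) - nuFun (a', b', c') (-x) = -(nuFun (a, b, c) x - nuFun (a', b', c') x)) :
    False := by
  haveI : Fact p.Prime := ⟨hp⟩
  obtain ⟨n2, n3, n4, n5, n7, n8, n9, n13, n15⟩ := numerals (p := p) hp hp11 hp13
  have hbc : 3 ∣ b' + c' := by have := three_dvd hs'; omega
  refine core31 n2 n3 n5 n9 (I := ((a / 3 : ℕ) : ZMod p)) (J := ((b / 3 : ℕ) : ZMod p)) (K := ((c / 3 : ℕ) : ZMod p))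
    (zsum_Z1 h3a' hs') (third_ne_zero hp ha' h3a') (cast_ne_zero hp hb')
    (third_ne_of_nmod h3a' h3a (fun h => hda h.symm)) (third_ne_of_nmod h3a' h3b (fun h => hdb h.symm))
    (third_ne_of_nmod h3a' h3c (fun h => hdc h.symm))
    (fun x => by simpa only [muFun_Z3 h3a h3b h3c, muFun_Z1 h3a' h3b' h3c'] using hE x) (fun x => ?_)
  have h := hD x
  simp only [nuFun_Z3 h3a h3b h3c, nuFun_Z1 h3a' h3b' h3c', chi3_neg h3b' hbc] at h
  have h' : chi3 b' * (-(ind ((b' : ZMod p) = -x) - ind ((c' : ZMod p) = -x)))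
      = chi3 b' * (ind ((b' : ZMod p) = x) - ind ((c' : ZMod p) = x)) := by linear_combination h
  exact mul_left_cancel₀ (chi3_ne_zero h3b') h'

/-- (Z1, Z1), both normalised as `(3y, u, v)` and ALIGNED: `u ≡ u′ (mod 3)` -/
theorem caseZ1Z1 (hp : p.Prime) (hp11 : 11 ≤ p) (hp13 : p ≠ 13) {a b c a' b' c' : ℕ}
    (h3a : 3 ∣ a) (h3b : ¬ 3 ∣ b) (h3c : ¬ 3 ∣ c) (h3a' : 3 ∣ a') (h3b' : ¬ 3 ∣ b') (h3c' : ¬ 3 ∣ c')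
    (hbb : b % 3 = b' % 3) (hs : 3 * p ∣ a + b + c) (hs' : 3 * p ∣ a' + b' + c')
    (ha : Nat.Coprime a p) (hb : Nat.Coprime b p) (hc : Nat.Coprime c p)
    (ha' : Nat.Coprime a' p) (hb' : Nat.Coprime b' p) (hc' : Nat.Coprime c' p)
    (hdb : ¬ b ≡ b' [MOD 3 * p]) (hdc : ¬ c ≡ c' [MOD 3 * p])
    (hE : ∀ x : ZMod p, muFun (a, b, c) (-x) - muFun (a', b', c') (-x) = muFun (a, b, c) x - muFun (a', b', c') x)
    (hD : ∀ x : ZMod p, nuFun (a, b, c) (-x) - nuFun (a', b', c') (-x) = -(nuFun (a, b, c) x - nuFun (a', b', c') x)) :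
    False := by
  haveI : Fact p.Prime := ⟨hp⟩
  have hp3 : p ≠ 3 := by omega
  obtain ⟨n2, n3, n4, n5, n7, n8, n9, n13, n15⟩ := numerals (p := p) hp hp11 hp13
  have h3s := three_dvd hs
  have h3s' := three_dvd hs'
  have hcc : c % 3 = c' % 3 := by omega
  have hbc : 3 ∣ b + c := by omega
  have hbc' : 3 ∣ b' + c' := by omega
  refine coreZZ n2 n3 n4 n5 n7 n9 n15 (zsum_Z1 h3a hs) (zsum_Z1 h3a' hs')
    (third_ne_zero hp ha h3a) (cast_ne_zero hp hb) (cast_ne_zero hp hc)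
    (third_ne_zero hp ha' h3a') (cast_ne_zero hp hb') (cast_ne_zero hp hc')
    (ne_of_nmod hp hp3 hbb hdb) (ne_of_nmod hp hp3 hcc hdc)
    (fun x => by simpa only [muFun_Z1 h3a h3b h3c, muFun_Z1 h3a' h3b' h3c'] using hE x) (fun x => ?_)
  have h := hD x
  simp only [nuFun_Z1 h3a h3b h3c, nuFun_Z1 h3a' h3b' h3c', chi3_neg h3b hbc, chi3_neg h3b' hbc',
    chi3_congr hbb] at h
  have h' : chi3 b' * dZ (b : ZMod p) (c : ZMod p) (b' : ZMod p) (c' : ZMod p) (-x)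
      = chi3 b' * (-dZ (b : ZMod p) (c : ZMod p) (b' : ZMod p) (c' : ZMod p) x) := by
    unfold dZ; linear_combination h
  exact mul_left_cancel₀ (chi3_ne_zero h3b') h'

/-- (U, U) -/
theorem caseUU (hp : p.Prime) (hp11 : 11 ≤ p) (hp13 : p ≠ 13) {a b c a' b' c' : ℕ}
    (h3a : ¬ 3 ∣ a) (h3b : ¬ 3 ∣ b) (h3c : ¬ 3 ∣ c) (h3a' : ¬ 3 ∣ a') (h3b' : ¬ 3 ∣ b') (h3c' : ¬ 3 ∣ c')
    (hs : 3 * p ∣ a + b + c) (hs' : 3 * p ∣ a' + b' + c')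
    (ha : Nat.Coprime a p) (hb : Nat.Coprime b p) (hc : Nat.Coprime c p)
    (hD : ∀ u v, (u = a ∨ u = b ∨ u = c) → (v = a' ∨ v = b' ∨ v = c') → ¬ u ≡ v [MOD 3 * p])
    (hsum : chi3 a + chi3 b + chi3 c = chi3 a' + chi3 b' + chi3 c')
    (hE : ∀ x : ZMod p, muFun (a, b, c) (-x) - muFun (a', b', c') (-x) = muFun (a, b, c) x - muFun (a', b', c') x)
    (hDD : ∀ x : ZMod p, nuFun (a, b, c) (-x) - nuFun (a', b', c') (-x) = -(nuFun (a, b, c) x - nuFun (a', b', c') x)) :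
    False := by
  haveI : Fact p.Prime := ⟨hp⟩
  have hp3 : p ≠ 3 := by omega
  obtain ⟨n2, n3, n4, n5, n7, n8, n9, n13, n15⟩ := numerals (p := p) hp hp11 hp13
  have h3s := three_dvd hs
  have h3s' := three_dvd hs'
  have hab : a % 3 = b % 3 := by omega
  have hac : a % 3 = c % 3 := by omega
  have hab' : a' % 3 = b' % 3 := by omega
  have hac' : a' % 3 = c' % 3 := by omega
  have haa : a % 3 = a' % 3 := by
    rw [← chi3_congr hab, ← chi3_congr hac, ← chi3_congr hab', ← chi3_congr hac'] at hsum
    exact mod_eq_of_chi3_eq h3a (by linarith)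
  have dj : ∀ {u v : ℕ}, (u = a ∨ u = b ∨ u = c) → (v = a' ∨ v = b' ∨ v = c') → u % 3 = v % 3 →
      (v : ZMod p) ≠ (u : ZMod p) := fun hu hv h => ne_of_nmod hp hp3 h (hD _ _ hu hv)
  refine coreUU n2 n4 n8 n13 (zsum_U hs) (cast_ne_zero hp ha) (cast_ne_zero hp hb) (cast_ne_zero hp hc)
    (dj (Or.inl rfl) (Or.inl rfl) haa) (dj (Or.inl rfl) (Or.inr (Or.inl rfl)) (by omega))
    (dj (Or.inl rfl) (Or.inr (Or.inr rfl)) (by omega)) (dj (Or.inr (Or.inl rfl)) (Or.inl rfl) (by omega))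
    (dj (Or.inr (Or.inl rfl)) (Or.inr (Or.inl rfl)) (by omega)) (dj (Or.inr (Or.inl rfl)) (Or.inr (Or.inr rfl)) (by omega))
    (dj (Or.inr (Or.inr rfl)) (Or.inl rfl) (by omega)) (dj (Or.inr (Or.inr rfl)) (Or.inr (Or.inl rfl)) (by omega))
    (dj (Or.inr (Or.inr rfl)) (Or.inr (Or.inr rfl)) (by omega))
    (fun x => by simpa only [muFun_U h3a h3b h3c, muFun_U h3a' h3b' h3c'] using hE x) (fun x => ?_)
  have h := hDD x
  simp only [nuFun_U h3a h3b h3c, nuFun_U h3a' h3b' h3c', ← chi3_congr hab, ← chi3_congr hac, ← chi3_congr haa,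
    ← chi3_congr (haa.trans hab'), ← chi3_congr (haa.trans hac')] at h
  have h' : chi3 a * (nU (a : ZMod p) (b : ZMod p) (c : ZMod p) (-x)
        - nU (a' : ZMod p) (b' : ZMod p) (c' : ZMod p) (-x))
      = chi3 a * (-(nU (a : ZMod p) (b : ZMod p) (c : ZMod p) x
        - nU (a' : ZMod p) (b' : ZMod p) (c' : ZMod p) x)) := by
    unfold nU; linear_combination h
  exact mul_left_cancel₀ (chi3_ne_zero h3a) h'

/-! ### permutations of the entries preserve the CM type (re-proved from `LemmaN.rsum_cases`, cf. `RowsFinal`) -/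

/-- `SameType` is symmetric -/
lemma st_symm {N : ℕ} {T T' : ℕ × ℕ × ℕ} (h : SameType N T T') : SameType N T' T :=
  fun t ht => (h t ht).symm

/-- `SameType` is transitive -/
lemma st_trans {N : ℕ} {T T' T'' : ℕ × ℕ × ℕ} (h : SameType N T T') (h' : SameType N T' T'') :
    SameType N T T'' := fun t ht => (h t ht).trans (h' t ht)

/-- a unit `t` mod `N` does not make `tw` divisible by `N` unless `w` is -/
lemma unit_mul_not_dvd {N t w : ℕ} (ht : Nat.Coprime t N) (hw : ¬ N ∣ w) : ¬ N ∣ t * w :=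
  fun h => hw (ht.symm.dvd_of_dvd_mul_left h)

/-- `rsum` is symmetric in the first two entries -/
lemma rsum_swap (N x y z t : ℕ) : rsum N (y, x, z) t = rsum N (x, y, z) t := by
  unfold rsum; dsimp only; ring

/-- `rsum` is invariant under rotating the entries -/
lemma rsum_rot (N x y z t : ℕ) : rsum N (z, x, y) t = rsum N (x, y, z) t := by
  unfold rsum; dsimp only; ring

/-- swapping the first two entries preserves the CM type (third entry `≢ 0`) -/
lemma st_swap {N x y z : ℕ} (hN : 0 < N) (hs : N ∣ x + y + z) (hz : ¬ N ∣ z) :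
    SameType N (x, y, z) (y, x, z) := by
  intro t ht
  have hs' : N ∣ y + x + z := by rwa [Nat.add_comm y x]
  rw [(rsum_cases hN hs (unit_mul_not_dvd ht hz)).2, (rsum_cases hN hs' (unit_mul_not_dvd ht hz)).2,
    rsum_swap N x y z t]

/-- rotating the entries preserves the CM type (second and third entries `≢ 0`) -/
lemma st_rot {N x y z : ℕ} (hN : 0 < N) (hs : N ∣ x + y + z) (hy : ¬ N ∣ y) (hz : ¬ N ∣ z) :
    SameType N (x, y, z) (z, x, y) := by
  intro t ht
  have hs' : N ∣ z + x + y := by rwa [show z + x + y = x + y + z by ring]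
  rw [(rsum_cases hN hs (unit_mul_not_dvd ht hz)).2, (rsum_cases hN hs' (unit_mul_not_dvd ht hy)).2,
    rsum_rot N x y z t]

/-! ### assembly -/

/-- THEOREM F*(3p) for two triples whose 3-patterns are both in normal form (U, or Z1 with the 3-divisible entry first, or Z3) -/
theorem thmFstar_nf (h0 : H0) (hp : p.Prime) (hp11 : 11 ≤ p) (hp13 : p ≠ 13) {a b c a' b' c' : ℕ}
    (hn : (¬ 3 ∣ a ∧ ¬ 3 ∣ b ∧ ¬ 3 ∣ c) ∨ (3 ∣ a ∧ ¬ 3 ∣ b ∧ ¬ 3 ∣ c) ∨ (3 ∣ a ∧ 3 ∣ b ∧ 3 ∣ c))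
    (hn' : (¬ 3 ∣ a' ∧ ¬ 3 ∣ b' ∧ ¬ 3 ∣ c') ∨ (3 ∣ a' ∧ ¬ 3 ∣ b' ∧ ¬ 3 ∣ c') ∨ (3 ∣ a' ∧ 3 ∣ b' ∧ 3 ∣ c'))
    (hs : 3 * p ∣ a + b + c) (hs' : 3 * p ∣ a' + b' + c')
    (ha : Nat.Coprime a p) (hb : Nat.Coprime b p) (hc : Nat.Coprime c p)
    (ha' : Nat.Coprime a' p) (hb' : Nat.Coprime b' p) (hc' : Nat.Coprime c' p)
    (hD : ∀ u v, (u = a ∨ u = b ∨ u = c) → (v = a' ∨ v = b' ∨ v = c') → ¬ u ≡ v [MOD 3 * p])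
    (hT : SameType (3 * p) (a, b, c) (a', b', c')) : False := by
  have hp3 : p ≠ 3 := by omega
  have hN : 0 < 3 * p := by omega
  have h3s := three_dvd hs
  have h3s' := three_dvd hs'
  have hsum := nu_sum_eq' h0 hp hp11 hp13 hs hs' ha hb hc ha' hb' hc' hT
  have hE := mu_even h0 hp hp3 hs hs' ha hb hc ha' hb' hc' hT
  have hDD := nu_odd' h0 hp hp11 hp13 hs hs' ha hb hc ha' hb' hc' hT
  rcases hn with ⟨h3a, h3b, h3c⟩ | ⟨h3a, h3b, h3c⟩ | ⟨h3a, h3b, h3c⟩ <;>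
    rcases hn' with ⟨h3a', h3b', h3c'⟩ | ⟨h3a', h3b', h3c'⟩ | ⟨h3a', h3b', h3c'⟩
  · exact caseUU hp hp11 hp13 h3a h3b h3c h3a' h3b' h3c' hs hs' ha hb hc hD hsum hE hDD
  · exact sum3_U h3s h3a h3b h3c (hsum.trans (sum3_Z h3s' h3a'))
  · exact sum3_U h3s h3a h3b h3c (hsum.trans (sum3_Z h3s' h3a'))
  · exact sum3_U h3s' h3a' h3b' h3c' (hsum.symm.trans (sum3_Z h3s h3a))
  · by_cases hbb : b % 3 = b' % 3
    · exact caseZ1Z1 hp hp11 hp13 h3a h3b h3c h3a' h3b' h3c' hbb hs hs' ha hb hc ha' hb' hc'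
        (hD b b' (Or.inr (Or.inl rfl)) (Or.inr (Or.inl rfl))) (hD c c' (Or.inr (Or.inr rfl)) (Or.inr (Or.inr rfl))) hE hDD
    · have hbc : b % 3 = c' % 3 := by omega
      have hs2 : 3 * p ∣ a' + c' + b' := by rwa [Nat.add_right_comm]
      have hs3 : 3 * p ∣ c' + a' + b' := by rwa [show c' + a' + b' = a' + b' + c' by ring]
      have hT2 : SameType (3 * p) (a, b, c) (a', c', b') :=
        st_trans hT (st_trans (st_rot hN hs' (ndvd_of_coprime hp hb') (ndvd_of_coprime hp hc'))
          (st_swap hN hs3 (ndvd_of_coprime hp hb')))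
      exact caseZ1Z1 hp hp11 hp13 h3a h3b h3c h3a' h3c' h3b' hbc hs hs2 ha hb hc ha' hc' hb'
        (hD b c' (Or.inr (Or.inl rfl)) (Or.inr (Or.inr rfl))) (hD c b' (Or.inr (Or.inr rfl)) (Or.inr (Or.inl rfl)))
        (mu_even h0 hp hp3 hs hs2 ha hb hc ha' hc' hb' hT2) (nu_odd' h0 hp hp11 hp13 hs hs2 ha hb hc ha' hc' hb' hT2)
  · exact caseZ3Z1 hp hp11 hp13 h3a' h3b' h3c' h3a h3b h3c hs ha hb
      (fun h => hD a a' (Or.inl rfl) (Or.inl rfl) h.symm) (fun h => hD a b' (Or.inl rfl) (Or.inr (Or.inl rfl)) h.symm)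
      (fun h => hD a c' (Or.inl rfl) (Or.inr (Or.inr rfl)) h.symm)
      (mu_even h0 hp hp3 hs' hs ha' hb' hc' ha hb hc (st_symm hT)) (nu_odd' h0 hp hp11 hp13 hs' hs ha' hb' hc' ha hb hc (st_symm hT))
  · exact sum3_U h3s' h3a' h3b' h3c' (hsum.symm.trans (sum3_Z h3s h3a))
  · exact caseZ3Z1 hp hp11 hp13 h3a h3b h3c h3a' h3b' h3c' hs' ha' hb'
      (hD a a' (Or.inl rfl) (Or.inl rfl)) (hD b a' (Or.inr (Or.inl rfl)) (Or.inl rfl)) (hD c a' (Or.inr (Or.inr rfl)) (Or.inl rfl))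
      hE hDD
  · exact caseZ3Z3 hp hp11 hp13 h3a h3b h3c h3a' h3b' h3c' hs ha hb hc
      (hD a a' (Or.inl rfl) (Or.inl rfl)) (hD a b' (Or.inl rfl) (Or.inr (Or.inl rfl))) (hD a c' (Or.inl rfl) (Or.inr (Or.inr rfl)))
      hE

/-- THEOREM F*(3p), the first triple in 3-normal form -/
theorem thmFstar_nf1 (h0 : H0) (hp : p.Prime) (hp11 : 11 ≤ p) (hp13 : p ≠ 13) {a b c a' b' c' : ℕ}
    (hn : (¬ 3 ∣ a ∧ ¬ 3 ∣ b ∧ ¬ 3 ∣ c) ∨ (3 ∣ a ∧ ¬ 3 ∣ b ∧ ¬ 3 ∣ c) ∨ (3 ∣ a ∧ 3 ∣ b ∧ 3 ∣ c))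
    (hs : 3 * p ∣ a + b + c) (hs' : 3 * p ∣ a' + b' + c')
    (ha : Nat.Coprime a p) (hb : Nat.Coprime b p) (hc : Nat.Coprime c p)
    (ha' : Nat.Coprime a' p) (hb' : Nat.Coprime b' p) (hc' : Nat.Coprime c' p)
    (hD : ∀ u v, (u = a ∨ u = b ∨ u = c) → (v = a' ∨ v = b' ∨ v = c') → ¬ u ≡ v [MOD 3 * p])
    (hT : SameType (3 * p) (a, b, c) (a', b', c')) : False := by
  have hN : 0 < 3 * p := by omega
  have h3s' := three_dvd hs'
  have nb' := ndvd_of_coprime hp hb'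
  have nc' := ndvd_of_coprime hp hc'
  by_cases h3a' : 3 ∣ a' <;> by_cases h3b' : 3 ∣ b' <;> by_cases h3c' : 3 ∣ c'
  · exact thmFstar_nf h0 hp hp11 hp13 hn (Or.inr (Or.inr ⟨h3a', h3b', h3c'⟩)) hs hs' ha hb hc ha' hb' hc' hD hT
  · omega
  · omega
  · exact thmFstar_nf h0 hp hp11 hp13 hn (Or.inr (Or.inl ⟨h3a', h3b', h3c'⟩)) hs hs' ha hb hc ha' hb' hc' hD hT
  · omega
  · have hs2 : 3 * p ∣ b' + a' + c' := by rwa [Nat.add_comm b' a']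
    exact thmFstar_nf h0 hp hp11 hp13 hn (Or.inr (Or.inl ⟨h3b', h3a', h3c'⟩)) hs hs2 ha hb hc hb' ha' hc'
      (fun u v hu hv => hD u v hu (by tauto)) (st_trans hT (st_swap hN hs' nc'))
  · have hs2 : 3 * p ∣ c' + a' + b' := by rwa [show c' + a' + b' = a' + b' + c' by ring]
    exact thmFstar_nf h0 hp hp11 hp13 hn (Or.inr (Or.inl ⟨h3c', h3a', h3b'⟩)) hs hs2 ha hb hc hc' ha' hb'
      (fun u v hu hv => hD u v hu (by tauto)) (st_trans hT (st_rot hN hs' nb' nc'))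
  · exact thmFstar_nf h0 hp hp11 hp13 hn (Or.inl ⟨h3a', h3b', h3c'⟩) hs hs' ha hb hc ha' hb' hc' hD hT

/-- **THEOREM F\* at the prime levels `3p`, `p ≥ 11`, `p ≠ 13` (from `H0`).**  Two zero-sum triples mod `3p` with entries prime to
`p` which are DISJOINT mod `3p` never have the same CM type.  (`DecodingFinal.thmFstar` removes `h0`.) -/
theorem thmFstar (h0 : H0) (hp : p.Prime) (hp11 : 11 ≤ p) (hp13 : p ≠ 13) {a b c a' b' c' : ℕ}
    (hs : 3 * p ∣ a + b + c) (hs' : 3 * p ∣ a' + b' + c')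
    (ha : Nat.Coprime a p) (hb : Nat.Coprime b p) (hc : Nat.Coprime c p)
    (ha' : Nat.Coprime a' p) (hb' : Nat.Coprime b' p) (hc' : Nat.Coprime c' p)
    (hD : ∀ u v, (u = a ∨ u = b ∨ u = c) → (v = a' ∨ v = b' ∨ v = c') → ¬ u ≡ v [MOD 3 * p])
    (hT : SameType (3 * p) (a, b, c) (a', b', c')) : False := by
  have hN : 0 < 3 * p := by omega
  have h3s := three_dvd hs
  have nb := ndvd_of_coprime hp hb
  have nc := ndvd_of_coprime hp hc
  by_cases h3a : 3 ∣ a <;> by_cases h3b : 3 ∣ b <;> by_cases h3c : 3 ∣ c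
  · exact thmFstar_nf1 h0 hp hp11 hp13 (Or.inr (Or.inr ⟨h3a, h3b, h3c⟩)) hs hs' ha hb hc ha' hb' hc' hD hT
  · omega
  · omega
  · exact thmFstar_nf1 h0 hp hp11 hp13 (Or.inr (Or.inl ⟨h3a, h3b, h3c⟩)) hs hs' ha hb hc ha' hb' hc' hD hT
  · omega
  · have hs2 : 3 * p ∣ b + a + c := by rwa [Nat.add_comm b a]
    exact thmFstar_nf1 h0 hp hp11 hp13 (Or.inr (Or.inl ⟨h3b, h3a, h3c⟩)) hs2 hs' hb ha hc ha' hb' hc'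
      (fun u v hu hv => hD u v (by tauto) hv) (st_trans (st_swap hN hs2 nc) hT)
  · have hs2 : 3 * p ∣ c + a + b := by rwa [show c + a + b = a + b + c by ring]
    exact thmFstar_nf1 h0 hp hp11 hp13 (Or.inr (Or.inl ⟨h3c, h3a, h3b⟩)) hs2 hs' hc ha hb ha' hb' hc'
      (fun u v hu hv => hD u v (by tauto) hv) (st_trans (st_symm (st_rot hN hs nb nc)) hT)
  · exact thmFstar_nf1 h0 hp hp11 hp13 (Or.inl ⟨h3a, h3b, h3c⟩) hs hs' ha hb hc ha' hb' hc' hD hT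

end Level

end HodgeFermat.KRFree.Decoding
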